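import Summits.AtomisticToContinuum.FouriersLaw.Theorems.VanishingNoiseTransferNoiseLocalityReductionAux

/-!
# Fixed-`N` continuity of the linear-response coefficient in the velocity-flip rate at `0⁺`

Helper file of crux `NoiseLocality` (stmt-AtomisticToContinuum-11975), line lead `prover-line-stmt-AtomisticToContinuum-11975-c1-0`.

For the pinned anharmonic chain `pinnedChain ω₂ lam β γ` (all parameters `> 0`) of FIXED length `N`, the response coefficient
`D_N(ε)` of the unique rate-`ε` flip-noisy steady family at temperature `T` converges to the deterministic one, `D_N(0)`, as the
flip rate `ε ↓ 0`, with the explicit modulus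

  `|D_N(ε) − D_N(0)| ≤ T² K ε + T √(K · D_N(0)) · √ε`,   `K = max(0, (N−1) · 𝓔_f(U₀))`,

`𝓔_f(U₀) = ½ Σ_i ∫ (U₀ − U₀∘Θ_i)² dμ_T` the flip Dirichlet energy of ANY response density `U₀` of the deterministic family
(`abs_sub_le_modulus`); in particular `D_N(ε) → D_N(0)` along every choice of unique flip-steady families (`tendsto_response_zero_noise`).
This is input (i) "fixed-`N` continuity at `ε = 0⁺`" of the road map `Cruxes/NoiseLocality/Disproof.lean §5b`
(`localityShape_of_parts`) and the `ε → 0⁺` end of stub `stub_responseContinuousInNoise` of line `fekete-transposed-uniformity`;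
it is NOT `N`-uniform (the constant `K = K_N` is the flip susceptibility whose `N`-uniform control is the open stub C⁺ of line
`relative-flip-energy-transfer`).  Inputs: the landed fixed-`N` stubs of that line — response densities
(`stub_responseDensityDet`, `stub_responseDensityNoisy`), Duhamel in the flip form (`stub_duhamelFlipBound`), the dissipation bound
(`stub_flipDissipationBound`) — through the squared master inequality `Reduction.master_sq`, plus `Reduction.responseCoeff_nonneg`.
-/

noncomputable section

open MeasureTheory Filter Topology
open scoped ContDiff BigOperators

namespace Summit.AtomisticToContinuum.FouriersLaw.Theorems.NoiseLocality.FixedN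

open Literature.MathematicalPhysics.KineticTheory.HeatConduction
open Summit.AtomisticToContinuum.FouriersLaw.Theorems.NoiseLocality.Reduction (master_sq flipEnergy_nonneg responseCoeff_nonneg)

/-- Real algebra: `x² ≤ a (b + x)` with `a, b ≥ 0` forces `x ≤ a + √(a b)`. [folklore] -/
theorem le_add_sqrt_of_sq_le {x a b : ℝ} (ha : 0 ≤ a) (hb : 0 ≤ b) (h : x ^ 2 ≤ a * (b + x)) :
    x ≤ a + Real.sqrt (a * b) := by
  by_contra hlt
  push Not at hlt
  set s := Real.sqrt (a * b) with hs_def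
  have hs : 0 ≤ s := Real.sqrt_nonneg _
  have hs2 : s ^ 2 = a * b := Real.sq_sqrt (mul_nonneg ha hb)
  have h1 : s < x - a := by linarith
  have hxa : 0 < x - a := lt_of_le_of_lt hs h1
  have hsx : s < x := by linarith
  have h2 : s * s ≤ (x - a) * s := mul_le_mul_of_nonneg_right h1.le hs
  have h3 : (x - a) * s < (x - a) * x := mul_lt_mul_of_pos_left hsx hxa
  have h4 : a * b < x ^ 2 - a * x := by nlinarith
  have h5 : x ^ 2 ≤ a * b + a * x := by linarith
  linarith

/-- A response coefficient of a currentless chain (`N = 0`) is `0`. [folklore] -/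
theorem response_eq_zero_of_zero (P : OscillatorChain) (μ : ℝ → ℝ → Measure (PhaseSpace 0)) (T D : ℝ)
    (hD : Tendsto (fun δ : ℝ => P.totalCurrent (μ (T + δ / 2) (T - δ / 2)) / δ) (𝓝[≠] 0) (𝓝 D)) : D = 0 := by
  haveI : (𝓝[≠] (0 : ℝ)).NeBot := NormedField.nhdsNE_neBot 0
  have h : Tendsto (fun _ : ℝ => (0 : ℝ)) (𝓝[≠] (0 : ℝ)) (𝓝 D) := by
    simpa only [OscillatorChain.totalCurrent_zero, zero_div] using hD
  exact tendsto_nhds_unique h tendsto_const_nhds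

/-- **Fixed-`N` noise continuity of the response, explicit modulus.** For `pinnedChain ω₂ lam β γ` (all `> 0`), `T > 0`, any
length `N`, the unique deterministic weak steady family `μ0` with ANY response density `U0` at `T` and response coefficient `D0`,
and, at any flip rate `ε > 0`, the unique rate-`ε` flip-steady family `με` with response coefficient `Dε`:
`|Dε − D0| ≤ T² K ε + T √(K D0) √ε` with `K = max(0, (N−1)·½Σ_i∫(U0 − U0∘Θ_i)² dμ_T)`.
Proof: squared master inequality `|Dε − D0|² ≤ T² ε Dε (N−1)𝓔_f(U0)` (landed stubs 1b, 2, 3 via `Reduction.master_sq`),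
`Dε ≤ D0 + |Dε − D0|`, `D0 ≥ 0` (`Reduction.responseCoeff_nonneg`), and `x² ≤ a(b + x) ⇒ x ≤ a + √(ab)`. [folklore] -/
theorem abs_sub_le_modulus {ω₂ lam β γ : ℝ} (hω : 0 < ω₂) (hl : 0 < lam) (hβ : 0 < β) (hγ : 0 < γ)
    {T : ℝ} (hT : 0 < T) (N : ℕ) {ε : ℝ} (hε : 0 < ε)
    (μ0 με : ℝ → ℝ → Measure (PhaseSpace N))
    (hμ0 : ∀ T_L T_R : ℝ, 0 < T_L → 0 < T_R → (pinnedChain ω₂ lam β γ).IsSteadyState N T_L T_R (μ0 T_L T_R) ∧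
      ∀ ν : Measure (PhaseSpace N), (pinnedChain ω₂ lam β γ).IsSteadyState N T_L T_R ν → ν = μ0 T_L T_R)
    (hμε : ∀ T_L T_R : ℝ, 0 < T_L → 0 < T_R → (pinnedChain ω₂ lam β γ).IsFlipSteadyState N T_L T_R ε (με T_L T_R) ∧
      ∀ ν : Measure (PhaseSpace N), (pinnedChain ω₂ lam β γ).IsFlipSteadyState N T_L T_R ε ν → ν = με T_L T_R)
    (U0 : PhaseSpace N → ℝ)
    (hU0 : MemLp U0 2 ((pinnedChain ω₂ lam β γ).gibbsMeasure N T) ∧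
      (∀ g : PhaseSpace N → ℝ, ContDiff ℝ ((⊤ : ℕ∞) : WithTop ℕ∞) g → HasCompactSupport g →
        HasDerivAt (fun δ : ℝ => ∫ x, g x ∂(μ0 (T + δ / 2) (T - δ / 2)))
          (∫ x, g x * U0 x ∂((pinnedChain ω₂ lam β γ).gibbsMeasure N T)) 0) ∧
      HasDerivAt (fun δ : ℝ => (pinnedChain ω₂ lam β γ).totalCurrent (μ0 (T + δ / 2) (T - δ / 2)))
        (∑ i : Fin N, ∫ x, (pinnedChain ω₂ lam β γ).bondCurrent N i x * U0 x ∂((pinnedChain ω₂ lam β γ).gibbsMeasure N T)) 0)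
    {D0 Dε : ℝ}
    (hD0 : Tendsto (fun δ : ℝ => (pinnedChain ω₂ lam β γ).totalCurrent (μ0 (T + δ / 2) (T - δ / 2)) / δ) (𝓝[≠] 0) (𝓝 D0))
    (hDε : Tendsto (fun δ : ℝ => (pinnedChain ω₂ lam β γ).totalCurrent (με (T + δ / 2) (T - δ / 2)) / δ) (𝓝[≠] 0) (𝓝 Dε)) :
    |Dε - D0| ≤ T ^ 2 * max 0 (((N : ℝ) - 1) * ((1 / 2) * ∑ i : Fin N, ∫ x,
          (U0 x - U0 (momentumFlip i x)) ^ 2 ∂((pinnedChain ω₂ lam β γ).gibbsMeasure N T))) * ε +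
      T * Real.sqrt (max 0 (((N : ℝ) - 1) * ((1 / 2) * ∑ i : Fin N, ∫ x,
          (U0 x - U0 (momentumFlip i x)) ^ 2 ∂((pinnedChain ω₂ lam β γ).gibbsMeasure N T))) * D0) * Real.sqrt ε := by
  set P := pinnedChain ω₂ lam β γ with hP
  set E0 : ℝ := (1 / 2) * ∑ i : Fin N, ∫ x, (U0 x - U0 (momentumFlip i x)) ^ 2 ∂(P.gibbsMeasure N T) with hE0def
  set K : ℝ := max 0 (((N : ℝ) - 1) * E0) with hKdef
  have hK0 : 0 ≤ K := le_max_left _ _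
  rcases Nat.eq_zero_or_pos N with hN0 | hNpos
  · -- currentless: both responses vanish
    subst hN0
    have h0 : D0 = 0 := response_eq_zero_of_zero P μ0 T D0 hD0
    have h1 : Dε = 0 := response_eq_zero_of_zero P με T Dε hDε
    rw [h0, h1]
    simp only [sub_self, abs_zero]
    positivity
  -- `N ≥ 1`: the master inequality
  have hn : 0 ≤ (N : ℝ) - 1 := by
    have : (1 : ℝ) ≤ N := by exact_mod_cast hNpos
    linarith
  obtain ⟨Uε, hUε⟩ := Summit.AtomisticToContinuum.FouriersLaw.Theorems.NoiseLocality.stub_responseDensityNoisy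
    ω₂ lam β γ hω hl hβ hγ T hT N ε hε με hμε
  have h1 := Summit.AtomisticToContinuum.FouriersLaw.Theorems.NoiseLocality.stub_duhamelFlipBound
    ω₂ lam β γ hω hl hβ hγ T hT N ε hε μ0 με hμ0 hμε U0 Uε hU0 hUε D0 Dε hD0 hDε
  have h2 := Summit.AtomisticToContinuum.FouriersLaw.Theorems.NoiseLocality.stub_flipDissipationBound
    ω₂ lam β γ hω hl hβ hγ T hT N ε hε με hμε Uε hUε Dε hDε
  have hE0 : 0 ≤ E0 := flipEnergy_nonneg (P.gibbsMeasure N T) U0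
  have hEε := flipEnergy_nonneg (P.gibbsMeasure N T) Uε
  have key := master_sq hε.le hn hEε hE0 h1 h2
  -- `0 ≤ Dε` from the dissipation bound, `0 ≤ D0` from the corrector identity
  have hDε0 : 0 ≤ Dε := by
    refine le_trans ?_ h2
    have : 0 ≤ ε * ((N : ℝ) - 1) * T ^ 2 := mul_nonneg (mul_nonneg hε.le hn) (sq_nonneg T)
    exact mul_nonneg this hEε
  have hD00 : 0 ≤ D0 := responseCoeff_nonneg hω hl hβ hγ hT hμ0 hD0
  -- `|Dε - D0|² ≤ T² ε K (D0 + |Dε - D0|)`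
  set x := |Dε - D0| with hxdef
  have hDεle : Dε ≤ D0 + x := by
    have := le_abs_self (Dε - D0)
    linarith
  have hnE : ((N : ℝ) - 1) * E0 ≤ K := le_max_right _ _
  have key2 : x ^ 2 ≤ (T ^ 2 * K * ε) * (D0 + x) := by
    calc x ^ 2 ≤ T ^ 2 * (ε * Dε * (((N : ℝ) - 1) * E0)) := key
      _ ≤ T ^ 2 * (ε * Dε * K) := by
          apply mul_le_mul_of_nonneg_left _ (sq_nonneg T)
          exact mul_le_mul_of_nonneg_left hnE (mul_nonneg hε.le hDε0)
      _ ≤ T ^ 2 * (ε * (D0 + x) * K) := by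
          apply mul_le_mul_of_nonneg_left _ (sq_nonneg T)
          exact mul_le_mul_of_nonneg_right (mul_le_mul_of_nonneg_left hDεle hε.le) hK0
      _ = (T ^ 2 * K * ε) * (D0 + x) := by ring
  have ha : 0 ≤ T ^ 2 * K * ε := by positivity
  have hres := le_add_sqrt_of_sq_le ha hD00 key2
  -- rewrite `√(T² K ε · D0) = T √(K D0) √ε`
  have hsqrt : Real.sqrt (T ^ 2 * K * ε * D0) = T * Real.sqrt (K * D0) * Real.sqrt ε := by
    have e1 : T ^ 2 * K * ε * D0 = T ^ 2 * ((K * D0) * ε) := by ring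
    rw [e1, Real.sqrt_mul' _ (by positivity : 0 ≤ (K * D0) * ε), Real.sqrt_sq hT.le,
      Real.sqrt_mul (mul_nonneg hK0 hD00)]
    ring
  calc x ≤ T ^ 2 * K * ε + Real.sqrt (T ^ 2 * K * ε * D0) := hres
    _ = T ^ 2 * K * ε + T * Real.sqrt (K * D0) * Real.sqrt ε := by rw [hsqrt]

/-- **Fixed-`N` continuity at zero noise (limit form).** For `pinnedChain ω₂ lam β γ` (all `> 0`), `T > 0`, length `N`, the unique
deterministic family `μ0` with response `D0` at `T`, and ANY choice `ε ↦ (με ε, Dε ε)` of unique rate-`ε` flip-steady families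
with response coefficients for `ε` in a right neighbourhood of `0`: `Dε ε → D0` as `ε ↓ 0`. [folklore] -/
theorem tendsto_response_zero_noise {ω₂ lam β γ : ℝ} (hω : 0 < ω₂) (hl : 0 < lam) (hβ : 0 < β) (hγ : 0 < γ)
    {T : ℝ} (hT : 0 < T) (N : ℕ)
    (μ0 : ℝ → ℝ → Measure (PhaseSpace N))
    (hμ0 : ∀ T_L T_R : ℝ, 0 < T_L → 0 < T_R → (pinnedChain ω₂ lam β γ).IsSteadyState N T_L T_R (μ0 T_L T_R) ∧
      ∀ ν : Measure (PhaseSpace N), (pinnedChain ω₂ lam β γ).IsSteadyState N T_L T_R ν → ν = μ0 T_L T_R)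
    {D0 : ℝ}
    (hD0 : Tendsto (fun δ : ℝ => (pinnedChain ω₂ lam β γ).totalCurrent (μ0 (T + δ / 2) (T - δ / 2)) / δ) (𝓝[≠] 0) (𝓝 D0))
    (με : ℝ → ℝ → ℝ → Measure (PhaseSpace N)) (Dε : ℝ → ℝ)
    (hμε : ∀ᶠ ε in 𝓝[>] (0 : ℝ), ∀ T_L T_R : ℝ, 0 < T_L → 0 < T_R →
      (pinnedChain ω₂ lam β γ).IsFlipSteadyState N T_L T_R ε (με ε T_L T_R) ∧
        ∀ ν : Measure (PhaseSpace N), (pinnedChain ω₂ lam β γ).IsFlipSteadyState N T_L T_R ε ν → ν = με ε T_L T_R)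
    (hDε : ∀ᶠ ε in 𝓝[>] (0 : ℝ), Tendsto (fun δ : ℝ =>
      (pinnedChain ω₂ lam β γ).totalCurrent (με ε (T + δ / 2) (T - δ / 2)) / δ) (𝓝[≠] 0) (𝓝 (Dε ε))) :
    Tendsto Dε (𝓝[>] 0) (𝓝 D0) := by
  set P := pinnedChain ω₂ lam β γ with hP
  obtain ⟨U0, hU0⟩ := Summit.AtomisticToContinuum.FouriersLaw.Theorems.NoiseLocality.stub_responseDensityDet
    ω₂ lam β γ hω hl hβ hγ T hT N μ0 hμ0
  set K : ℝ := max 0 (((N : ℝ) - 1) * ((1 / 2) * ∑ i : Fin N, ∫ x,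
      (U0 x - U0 (momentumFlip i x)) ^ 2 ∂(P.gibbsMeasure N T))) with hKdef
  -- the modulus `m ε = T² K ε + T √(K D0) √ε → 0`
  set m : ℝ → ℝ := fun ε => T ^ 2 * K * ε + T * Real.sqrt (K * D0) * Real.sqrt ε with hmdef
  have hm : Tendsto m (𝓝[>] 0) (𝓝 0) := by
    have hcont : Continuous m := by
      simp only [hmdef]
      fun_prop
    have h := hcont.tendsto 0
    simp only [hmdef, mul_zero, Real.sqrt_zero, add_zero] at h
    exact h.mono_left nhdsWithin_le_nhds
  have hpos : ∀ᶠ ε in 𝓝[>] (0 : ℝ), 0 < ε := self_mem_nhdsWithin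
  have hbound : ∀ᶠ ε in 𝓝[>] (0 : ℝ), |Dε ε - D0| ≤ m ε := by
    filter_upwards [hμε, hDε, hpos] with ε h1 h2 h3
    exact abs_sub_le_modulus hω hl hβ hγ hT N h3 μ0 (με ε) hμ0 h1 U0 hU0 hD0 h2
  have habs : Tendsto (fun ε => |Dε ε - D0|) (𝓝[>] 0) (𝓝 0) :=
    squeeze_zero' (Eventually.of_forall fun ε => abs_nonneg _) hbound hm
  have := (tendsto_zero_iff_abs_tendsto_zero (f := fun ε => Dε ε - D0)).mpr habs
  simpa only [sub_add_cancel, zero_add] using this.add_const D0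

/-- Registered helper sub-goal `helper_fixedNNoiseContinuity` of crux stmt-AtomisticToContinuum-11975 = `abs_sub_le_modulus` in
registry form (fully qualified, parameters and rate universally quantified): the fixed-`N` modulus of continuity of the response
coefficient in the flip rate at `0⁺`. [folklore] -/
theorem helper_fixedNNoiseContinuity : ∀ ω₂ lam β γ : ℝ, 0 < ω₂ → 0 < lam → 0 < β → 0 < γ → ∀ T : ℝ, 0 < T → ∀ (N : ℕ) (ε : ℝ), 0 < ε → ∀ μ0 με : ℝ → ℝ → MeasureTheory.Measure (Literature.MathematicalPhysics.KineticTheory.HeatConduction.PhaseSpace N), (∀ T_L T_R : ℝ, 0 < T_L → 0 < T_R → (Literature.MathematicalPhysics.KineticTheory.HeatConduction.pinnedChain ω₂ lam β γ).IsSteadyState N T_L T_R (μ0 T_L T_R) ∧ ∀ ν : MeasureTheory.Measure (Literature.MathematicalPhysics.KineticTheory.HeatConduction.PhaseSpace N), (Literature.MathematicalPhysics.KineticTheory.HeatConduction.pinnedChain ω₂ lam β γ).IsSteadyState N T_L T_R ν → ν = μ0 T_L T_R) → (∀ T_L T_R : ℝ, 0 < T_L → 0 < T_R → (Literature.MathematicalPhysics.KineticTheory.HeatConduction.pinnedChain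 ω₂ lam β γ).IsFlipSteadyState N T_L T_R ε (με T_L T_R) ∧ ∀ ν : MeasureTheory.Measure (Literature.MathematicalPhysics.KineticTheory.HeatConduction.PhaseSpace N), (Literature.MathematicalPhysics.KineticTheory.HeatConduction.pinnedChain ω₂ lam β γ).IsFlipSteadyState N T_L T_R ε ν → ν = με T_L T_R) → ∀ U0 : Literature.MathematicalPhysics.KineticTheory.HeatConduction.PhaseSpace N → ℝ, (MeasureTheory.MemLp U0 2 ((Literature.MathematicalPhysics.KineticTheory.HeatConduction.pinnedChain ω₂ lam β γ).gibbsMeasure N T) ∧ (∀ g : Literature.MathematicalPhysics.KineticTheory.HeatConduction.PhaseSpace N → ℝ, ContDiff ℝ ((⊤ : ℕ∞) : WithTop ℕ∞) g → HasCompactSupport g → HasDerivAt (fun δ : ℝ => ∫ x, g x ∂(μ0 (T + δ / 2) (T - δ / 2))) (∫ x, g x * U0 x ∂((Literature.MathematicalPhysics.KineticTheory.HeatConduction.pinnedChain ω₂ lam β γ).gibbsMeasure N T)) 0) ∧ HasDerivAt (fun δ : ℝ => (Literature.MathematicalPhysics.KineticTheory.HeatConduction.pinnedChain ω₂ lam β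 γ).totalCurrent (μ0 (T + δ / 2) (T - δ / 2))) (∑ i : Fin N, ∫ x, (Literature.MathematicalPhysics.KineticTheory.HeatConduction.pinnedChain ω₂ lam β γ).bondCurrent N i x * U0 x ∂((Literature.MathematicalPhysics.KineticTheory.HeatConduction.pinnedChain ω₂ lam β γ).gibbsMeasure N T)) 0) → ∀ D0 Dε : ℝ, Filter.Tendsto (fun δ : ℝ => (Literature.MathematicalPhysics.KineticTheory.HeatConduction.pinnedChain ω₂ lam β γ).totalCurrent (μ0 (T + δ / 2) (T - δ / 2)) / δ) (nhdsWithin 0 {(0 : ℝ)}ᶜ) (nhds D0) → Filter.Tendsto (fun δ : ℝ => (Literature.MathematicalPhysics.KineticTheory.HeatConduction.pinnedChain ω₂ lam β γ).totalCurrent (με (T + δ / 2) (T - δ / 2)) / δ) (nhdsWithin 0 {(0 : ℝ)}ᶜ) (nhds Dε) → |Dε - D0| ≤ T ^ 2 * max 0 (((N : ℝ) - 1) * ((1 / 2) * ∑ i : Fin N, ∫ x, (U0 x - U0 (Literature.MathematicalPhysics.KineticTheory.HeatConduction.momentumFlip i x)) ^ 2 ∂((Literature.MathematicalPhysics.KineticTheory.HeatConduction.pinnedChain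 ω₂ lam β γ).gibbsMeasure N T))) * ε + T * Real.sqrt (max 0 (((N : ℝ) - 1) * ((1 / 2) * ∑ i : Fin N, ∫ x, (U0 x - U0 (Literature.MathematicalPhysics.KineticTheory.HeatConduction.momentumFlip i x)) ^ 2 ∂((Literature.MathematicalPhysics.KineticTheory.HeatConduction.pinnedChain ω₂ lam β γ).gibbsMeasure N T))) * D0) * Real.sqrt ε :=
  fun _ω₂ _lam _β _γ hω hl hβ hγ _T hT N _ε hε μ0 με hμ0 hμε U0 hU0 _D0 _Dε hD0 hDε =>
    abs_sub_le_modulus hω hl hβ hγ hT N hε μ0 με hμ0 hμε U0 hU0 hD0 hDε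

end Summit.AtomisticToContinuum.FouriersLaw.Theorems.NoiseLocality.FixedN

end
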